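import Summits.KontsevichZagierPeriods.KontsevichZagierPeriods.Theses.LinRedNormalForm
import Summits.KontsevichZagierPeriods.KontsevichZagierPeriods.Theorems.MzvKernelInKZTwoPosetsTransfer
import Summits.KontsevichZagierPeriods.KontsevichZagierPeriods.Theorems.MzvKernelInKZTwoPosetsEdsCertificateLow
import Summits.KontsevichZagierPeriods.KontsevichZagierPeriods.Theorems.MzvKernelInKZTwoPosetsFurushoBridge
import Summits.KontsevichZagierPeriods.KontsevichZagierPeriods.Theorems.MzvKernelInKZTwoPosetsShuffleProduct
import Summits.KontsevichZagierPeriods.KontsevichZagierPeriods.Theorems.FurushoPentagonStuffleInKZ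
import Summits.KontsevichZagierPeriods.KontsevichZagierPeriods.Theorems.FurushoPentagonHoffmanRelationInKZ
import Summits.KontsevichZagierPeriods.KontsevichZagierPeriods.Theorems.MzvKernelInKZ.Negative.Divergence

/-!
# Crux `LinRedNormalForm.HoffmanSpanInKZ` (stmt-KontsevichZagierPeriods-15044), line `Sketch`:
# the weight slices and the spanning transfer (registered stub `stub_spanTransfer`)

The crux: every MZV word generator `[Δ_w, q·∏ ω_ε]` is congruent modulo `KZ.relations` to a
`ℤ`-combination of Hoffman generators `[Δ_w, q'·ω_u]`, `u ∈ {2,3}^×`, `|u| = w`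
(lead `prover-line-stmt-KontsevichZagierPeriods-15044-0`; skeleton `Cruxes/HoffmanSpanInKZ/Lines/Sketch.lean`).

Contents:
* the weight slices `SpanAt w` of the crux (Hoffman generator set `hoffmanGens w` verbatim the crux's)
  and the read-back `hoffmanSpanInKZ_iff : HoffmanSpanInKZ ↔ ∀ w, SpanAt w` (`Iff.rfl`);
* **the spanning transfer** `spanAt_of_edsCertificate : EdsCertificate N → SpanAt N` (registered stub
  `stub_spanTransfer : SpanTransfer`): the spanning half of the two-posets transfer
  (`MzvKernelInKZTwoPosetsTransfer.transferCore`, crux 3914) re-targeted at this crux's generator set,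
  over the calculus half which is ENTIRELY LANDED — realisation bookkeeping `stub_realisation`, shuffle
  = dissection `stub_shuffleProduct`, stuffle `StuffleInKZ_of` (item 3931) + `stub_stuffleProductOfFurusho`,
  Hoffman's relation `hoffmanRelationInKZ_proof` (item 3930) + `stub_hoffmanDeepOfFurusho` /
  `stub_hoffmanDepthOneOfFurusho`, duality `duality_mem_relations`; the rational coefficient `q` is
  carried by `scaleQ` (integrand scaling, no division); an arbitrary generator is congruent to the
  canonical word representation by off-domain freedom; a non-admissible word carries no representation
  (`Negative/Divergence`), so it contributes a relation and `m = 0`;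
* **the rungs `N ≤ 6`, unconditional** (`spanAt_of_le_six`), from the landed certificates
  `stub_edsCertificateLow`. Higher rungs are the per-weight certificate stubs `stub_eds7 … stub_eds10`
  of the skeleton; the open tail is `∀ N ≥ 11, EdsCertificate N` (Ihara–Kaneko–Zagier 2006, Conj. 1).

Sources: F. Brown, *Mixed Tate motives over ℤ*, Ann. of Math. 175 (2012), Thm 1.1; K. Ihara, M. Kaneko,
D. Zagier, Compos. Math. 142 (2006), §1; M. E. Hoffman, Pacific J. Math. 152 (1992), Thm 5.1 and
J. Algebra 194 (1997); M. Kontsevich, D. Zagier, *Periods* (2001), §1.2.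
-/

noncomputable section

namespace Summit.KontsevichZagierPeriods.LinRedNormalForm.HoffmanSpanInKZ

open Set MeasureTheory
open Literature.NumberTheory.Transcendental
open Summit.KontsevichZagierPeriods.MzvKernelInKZ.Negative
open Summit.KontsevichZagierPeriods.MzvKernelInKZ.TwoPosets
open Summit.KontsevichZagierPeriods.KontsevichZagierPeriods.Theses.LinRedNormalForm (HoffmanSpanInKZ)

/-! ## The per-weight slices of the crux -/

/-- The Hoffman generator set of the crux in weight `w` (verbatim the set in `HoffmanSpanInKZ`):
classes `[Δ_w, q'·ω_u]` with `u ∈ {2,3}^×`, `|u| = w`, `q' ∈ ℚ` (a slice of the crux's data, not a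
published statement). -/
def hoffmanGens (w : ℕ) : Set KZ.FormalRep :=
  {x | ∃ (u : List ℕ) (q' : ℚ) (s' : KZ.IntegralRep (MZV.weight u)),
    MZV.IsHoffman u ∧ MZV.weight u = w ∧
    s'.domain = {t | (∀ i, 0 < t i) ∧ (∀ i, t i < 1) ∧ StrictAnti t} ∧
    EqOn s'.integrand (fun t => (q' : ℝ) * KZ.mzvIntegrand u t) s'.domain ∧ x = KZ.of s'}

/-- The weight-`w` slice of the crux: every MZV word generator of weight `w` is congruent modulo
`KZ.relations` to an element of the subgroup generated by the Hoffman generators of weight `w`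
(the crux is `∀ w, SpanAt w`, `hoffmanSpanInKZ_iff`). -/
def SpanAt (w : ℕ) : Prop :=
  ∀ (ε : Fin w → Bool) (q : ℚ) (s : KZ.IntegralRep w),
    s.domain = {t | (∀ i, 0 < t i) ∧ (∀ i, t i < 1) ∧ StrictAnti t} →
    EqOn s.integrand (fun t => (q : ℝ) * ∏ i, if ε i then 1 / (1 - t i) else 1 / t i) s.domain →
    ∃ m ∈ AddSubgroup.closure (hoffmanGens w), KZ.of s - m ∈ KZ.relations

/-- Read-back: the crux is the conjunction of its weight slices (definitional). -/
theorem hoffmanSpanInKZ_iff : HoffmanSpanInKZ ↔ ∀ w, SpanAt w := Iff.rfl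

/-! ## The glue: spanning at weight `N` from an EDS certificate at weight `N` -/

/-- The canonical word representation of a Hoffman index `u` of weight `N`, with any rational
coefficient, is a Hoffman generator of weight `N` (read through `zWord N (bword N u) q`). -/
theorem zWord_bword_mem_hoffmanGens {N : ℕ} {u : List ℕ} (hu : MZV.IsHoffman u)
    (hw : MZV.weight u = N) (q : ℚ) : zWord N (bword N u) q ∈ hoffmanGens N := by
  rw [zWord_bword_eq_zIdx hw, zIdx_of_adm hu.isAdmissible]
  refine ⟨u, q, wordRep (bword (MZV.weight u) u) q (adm_bword hu.isAdmissible), hu, hw, rfl, ?_, rfl⟩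
  intro t _
  simp only [wordRep_integrand]
  rw [wordFun_eq_mul_wordFun_one, wordFun_one_eq_prod_mzvForm]
  rfl

/-- The calculus half of the two-posets line, assembled from the tree: realisation bookkeeping,
Hoffman's relation in depth one and in depth `≥ 2` (route FurushoPentagon, item 3930), the
shuffle product (dissection) and the stuffle product (item 3931). -/
theorem calculusHalf :
    RealisationCompat ∧ HoffmanDepthOneInKZ ∧ ShuffleProductInKZ ∧ StuffleProductInKZ ∧
      HoffmanDeepInKZ :=
  ⟨stub_realisation,
    stub_hoffmanDepthOneOfFurusho FurushoPentagon.HoffmanRelationInKZ.hoffmanRelationInKZ_proof,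
    stub_shuffleProduct,
    stub_stuffleProductOfFurusho FurushoPentagon.StuffleInKZ.StuffleInKZ_of,
    stub_hoffmanDeepOfFurusho FurushoPentagon.HoffmanRelationInKZ.hoffmanRelationInKZ_proof⟩

/-- **Realised certificate.** From an EDS certificate at weight `N` and the (landed) calculus
half: the class of `[Δ_N, ω_ε]` equals the realisation of its Hoffman part, for admissible `ε`. -/
theorem real_unitVec_eq_of_edsCertificate {N : ℕ} (hE : EdsCertificate N) (ε : Fin N → Bool)
    (hε : Adm ε) :
    ∃ H : List (List ℕ × ℚ), (∀ p ∈ H, MZV.IsHoffman p.1 ∧ MZV.weight p.1 = N) ∧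
      real N (unitVec N ε) = real N (H.map fun p => p.2 • unitVec N (bword N p.1)).sum := by
  obtain ⟨hR, hH1, hSh, hSt, hHd⟩ := calculusHalf
  obtain ⟨H, F, D, K, hH, hF, hD, -, heq⟩ := hE ε hε
  refine ⟨H, hH, ?_⟩
  have hreal := congrArg (real N) heq
  have hF0 : real N (F.map fun p => p.2 • fdsVec N p.1.1 p.1.2).sum = 0 := by
    rw [real_list_sum hR, List.map_map]
    refine List.sum_eq_zero fun x hx => ?_
    obtain ⟨p, hp, rfl⟩ := List.mem_map.mp hx
    obtain ⟨h1, h2, h3, h4, h5⟩ := hF p hp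
    simp only [Function.comp_apply]
    rw [hR.2.1, real_fdsVec hR hSh hSt h1 h2 h3 h4 h5, map_zero]
  have hD0 : real N (D.map fun p => p.2 • hoffmanVec N p.1).sum = 0 := by
    rw [real_list_sum hR, List.map_map]
    refine List.sum_eq_zero fun x hx => ?_
    obtain ⟨p, hp, rfl⟩ := List.mem_map.mp hx
    obtain ⟨h1, h2⟩ := hD p hp
    simp only [Function.comp_apply]
    rw [hR.2.1, real_hoffmanVec hR hH1 hHd h1 h2, map_zero]
  have hK0 : real N (K.map fun p => p.2 • dualVec N p.1).sum = 0 := by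
    rw [real_list_sum hR, List.map_map]
    refine List.sum_eq_zero fun x hx => ?_
    obtain ⟨p, _, rfl⟩ := List.mem_map.mp hx
    simp only [Function.comp_apply]
    rw [hR.2.1, real_dualVec hR, map_zero]
  rw [hR.1, hR.1, hF0, hD0, hK0, add_zero, add_zero, real_sub hR, sub_eq_zero] at hreal
  exact hreal

/-- The sum of the rescaled Hoffman brackets of a certificate lies in the Hoffman closure. -/
theorem sum_zWord_mem_closure {N : ℕ} (q : ℚ) (H : List (List ℕ × ℚ))
    (hH : ∀ p ∈ H, MZV.IsHoffman p.1 ∧ MZV.weight p.1 = N) :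
    (H.map fun p => zWord N (bword N p.1) (q * p.2)).sum ∈ AddSubgroup.closure (hoffmanGens N) := by
  refine list_sum_mem fun x hx => ?_
  obtain ⟨p, hp, rfl⟩ := List.mem_map.mp hx
  exact AddSubgroup.subset_closure (zWord_bword_mem_hoffmanGens (hH p hp).1 (hH p hp).2 _)

/-- **GLUE (spanning transfer).** An EDS certificate at weight `N` gives the weight-`N` slice of
the crux: realise the certificate identity in `KZ.FormalRep ⧸ KZ.relations` (every relation vector
realises to `0` by the landed move chains), rescale by `q` through `scaleQ` (integrand scaling,
no division), and pass from the canonical word representation to an arbitrary generator by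
off-domain freedom; a non-admissible word forces `q = 0`, a zero representation, `m = 0`. -/
theorem spanAt_of_edsCertificate {N : ℕ} (hE : EdsCertificate N) : SpanAt N := by
  intro ε q s hd hi
  by_cases hε : Adm ε
  · obtain ⟨H, hH, hreal⟩ := real_unitVec_eq_of_edsCertificate hE ε hε
    have hR : RealisationCompat := stub_realisation
    -- rescale the realised identity by `q`
    have hq := congrArg (scaleQ q) hreal
    rw [hR.2.2.2, hR.2.2.1, real_list_sum hR, map_list_sum, List.map_map, List.map_map] at hq
    have hq' : (QuotientAddGroup.mk (zWord N ε (q * 1)) : KZ.FormalRep ⧸ KZ.relations) =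
        (H.map fun p => (QuotientAddGroup.mk (zWord N (bword N p.1) (q * p.2)) :
          KZ.FormalRep ⧸ KZ.relations)).sum := by
      rw [hq]
      congr 1
      refine List.map_congr_left fun p _ => ?_
      simp only [Function.comp_apply]
      rw [real_smul_unitVec hR, hR.2.2.1]
    rw [mul_one] at hq'
    -- back to `KZ.FormalRep`
    set m : KZ.FormalRep := (H.map fun p => zWord N (bword N p.1) (q * p.2)).sum with hm
    have hmk : (QuotientAddGroup.mk m : KZ.FormalRep ⧸ KZ.relations) =
        (H.map fun p => (QuotientAddGroup.mk (zWord N (bword N p.1) (q * p.2)) :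
          KZ.FormalRep ⧸ KZ.relations)).sum := by
      rw [hm]
      exact (map_list_sum (QuotientAddGroup.mk' KZ.relations) _).trans (by rw [List.map_map]; rfl)
    have hrel : zWord N ε q - m ∈ KZ.relations := by
      rw [← QuotientAddGroup.eq_iff_sub_mem, hmk]
      exact hq'
    refine ⟨m, sum_zWord_mem_closure q H hH, ?_⟩
    have hs : KZ.of s - KZ.of (wordRep ε q hε) ∈ KZ.relations :=
      of_sub_of_wordRep_mem_relations hε s hd hi
    rw [zWord_of_adm hε] at hrel
    have : KZ.of s - m = (KZ.of s - KZ.of (wordRep ε q hε)) + (KZ.of (wordRep ε q hε) - m) := by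
      abel
    rw [this]
    exact add_mem hs hrel
  · exact ⟨0, zero_mem _, by simpa using of_mem_relations_of_not_adm s hd hi hε⟩

/-- **Rungs `N ≤ 6`** (unconditional): the weight slices of the crux through weight `6`, from the
landed certificates `stub_edsCertificateLow`. -/
theorem spanAt_of_le_six {N : ℕ} (h : N ≤ 6) : SpanAt N :=
  spanAt_of_edsCertificate (stub_edsCertificateLow N h)

/-! ## The registered stub -/

/-- The spanning transfer in every weight: an EDS certificate at weight `N` gives the weight-`N`
slice of the crux (the lead's glue statement; proved below / in the SpanTransfer file). -/
def SpanTransfer : Prop := ∀ N : ℕ, EdsCertificate N → SpanAt N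

/-- **Registered stub `stub_spanTransfer`** of the skeleton of line `Sketch`: the spanning
transfer holds in every weight (the calculus half being landed). -/
theorem stub_spanTransfer : SpanTransfer := fun _ hE => spanAt_of_edsCertificate hE

end Summit.KontsevichZagierPeriods.LinRedNormalForm.HoffmanSpanInKZ
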